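import Summits.QuantumFields.YangMills.Theorems.BalabanUVNodesN22AtU3OfKernelsLimitExistence
import Summits.QuantumFields.YangMills.Theorems.BalabanUVNodesN22WindowOfLocalTerms
import Literature.MathematicalPhysics.QuantumFieldTheory.Balaban1983to89.Node00.LocalizedSum17

/-!
# «THIS LIMIT EXISTS BY THE LOCALIZED REPRESENTATION (1.7)» ([I] p. 264) AS A SCHEMA — the (1.21)-EXISTENCE twin of dag-n22-c's J27 `…N22WindowOfLocalTerms`:
# geometric VOLUME-INCREMENTS of the windowed kernels of a localized sum from (S) STABILITY of the small-domain partial sums across consecutive volumes and (T) geometric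
# two-point TAILS of the volume-feeling terms ⇒ def-B's `PolLimitExists` (via `…LimitExistence`), hence the existence input of the (1.21) passage of `…N22AtU3OfKernels`

Cell `pub-ymgap`, Track A (HUMAN RULING D-0062), WIDTH SEAT `dag-n22-w3` g2 on node n22 = NE9; `--kind proof --supports stmt-QuantumFields-20544 --as helper`,
COUNT-NEUTRAL.  RESERVED on the bus (pub-ymgap INBOX l.26334) as the sequel of J27 (dag-n22-c g11, `YMDAG.N22.WindowOfLocalTerms`, landed): J27 reads the HISTORY DIFFERENCE of the
windowed kernel of a localized sum `Σ_X ℰ_X` through `polScalar_finset_sum` + per-term bounds + a two-point tree sum; THIS file reads the VOLUME DIFFERENCE `Π^{(K+1)}(z) − Π^{(K)}(z)` of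
the windowed kernels of TWO localized sums on CONSECUTIVE tori the same way.  Print ([I] p. 264): «Now we take a limit of these functions as T^{(j+1)} ↗ Z^d. This limit exists by the
localized representation (1.7)» (and §5 p. 292–293: the tensor is taken «in the infinite volume limit in (5.1)», the decay (5.10) being «the basic reason why we have taken the
infinite volume limit») — the terms of domains that do not feel the volume are the same on every larger torus, and the volume-feeling ones are exponentially few by (1.18).

* §1 FINITE-SUM BOOKKEEPING: `abs_sum_sub_sum_le_of_stable` — two finite sums over possibly different index types whose «small» partial sums AGREE differ by at most the two «large»
  absolute tails.
* §2 AT def-B's SCALAR KERNEL: `abs_polScalar_sum_sub_polScalar_sum_le_of_stable_tail` — for two finite families of `𝔄`-valued-configuration functionals on two site types (the tori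
  `T^{(j)}_K`, `T^{(j)}_{K+1}`), each exponential chart twice continuously differentiable at `0` (J27's `polScalar_finset_sum`), (S) equality of the small partial sums of the
  per-term scalar kernels at the corresponding window sites and (T) tails `≤ τ, τ′` give `|Π′ − Π| ≤ τ + τ′`; `abs_polWindow_succ_sub_polWindow_le_of_stable_tail` — the same for
  def-B's `polWindow` at volumes `K + 1` and `K`, window sites `siteOfInt F · j z ∕ 0`.
* §3 ★ `polLimitExists_sum_of_stable_tail` — a `K`-indexed family of localized sums with (C²) charts, (S) from a threshold on and (T) geometric tails `C r^K`, `r < 1`, has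
  geometric volume-increments `2C·r^K`, hence (dag-n22-w3 `polLimitExists_of_eventually_geometric_increments`) def-B's `PolLimitExists`; ★ `polLimitExists_localizedSum_of_stable_tail`
  — the instance at def-W1's W1-20 `Node00.localizedSum F S emb k hist` (the (1.7) sum of a W1 reading, `Finset.univ` over the scale-(k+1) domains of the `K`-th torus), i.e. the
  `hlim` input of `ne9_EA_of_windowed` ∕ (5.10)'s passage at the kernel objects of the READING `objectsOfReading₁₃` from term-level laws.

HONEST FRAMING (binding).  Count-neutral bookkeeping (finite sums, the triangle inequality, J27's additivity, `…LimitExistence`'s Cauchy criterion); THEOREMS ONLY (0 def, 0 sorry,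
standard axioms).  The STABILITY law (S) (locality of the renormalization-group construction: the (2.13) term of a domain not wrapping the torus does not depend on the volume —
NODE A ∕ N10 ∕ def-W1 content) and the TAIL bound (T) ((1.18) decay + the tree-length resummation, uniform in the volume) are DISPLAYED HYPOTHESES; nothing of Bałaban's is
asserted or constructed; (1.21)'s existence for the terms OF RECORD is NOT proved here; N22 NOT discharged; K3⁷ OPEN, not claimed; no count claim; one finite 𝕋⁴ programme at fixed
ε — R4 closes the conditional rung `BalabanLadder.UV` only; NOTHING about the continuum limit, ℝ⁴, OS axioms, a mass gap or Clay is proved or claimed.  No cite tags (Summit side);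
TYPES only: [I] = [Balaban1987RG1] (1.7) p. 261, (1.18) p. 263, (1.20)–(1.21) p. 264, (5.1) p. 292, (5.10) p. 293 (pages read this session from
`paper:balaban1987-cmp109-rg-i-small-field` pp. 264, 292–293).
-/

noncomputable section

open Filter Topology
open scoped BigOperators

namespace YMDAG.N22.AtKernels

open Literature.MathematicalPhysics.QuantumFieldTheory.Balaban1983to89
open Literature.MathematicalPhysics.QuantumFieldTheory.Balaban1983to89.T4Continuum (T4Family)
open Literature.MathematicalPhysics.QuantumFieldTheory.Balaban1983to89.B12PolarizationTensor120 (expChart)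
open Literature.MathematicalPhysics.QuantumFieldTheory.Balaban1983to89.Node00 (polScalar polWindow siteOfInt PolLimitExists TermFamily1)
open YMDAG.N22.WindowOfLocalTerms (polScalar_finset_sum)

/-! ## §1 Finite-sum bookkeeping: stable small parts, two tails -/

/-- Two finite sums over possibly different index types whose «small» partial sums agree differ by at most the sum of the two «large» absolute tails. -/
theorem abs_sum_sub_sum_le_of_stable {α β : Type*} (s : Finset α) (s' : Finset β) (a : α → ℝ) (b : β → ℝ) (p : α → Prop) (q : β → Prop)
    [DecidablePred p] [DecidablePred q] (hstab : ∑ x ∈ s.filter p, a x = ∑ y ∈ s'.filter q, b y) {τ τ' : ℝ}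
    (hτ : ∑ x ∈ s.filter (fun x => ¬ p x), |a x| ≤ τ) (hτ' : ∑ y ∈ s'.filter (fun y => ¬ q y), |b y| ≤ τ') :
    |∑ y ∈ s', b y - ∑ x ∈ s, a x| ≤ τ + τ' := by
  rw [← Finset.sum_filter_add_sum_filter_not s' q, ← Finset.sum_filter_add_sum_filter_not s p, ← hstab]
  have e : (∑ x ∈ s.filter p, a x + ∑ y ∈ s'.filter (fun y => ¬ q y), b y) - (∑ x ∈ s.filter p, a x + ∑ x ∈ s.filter (fun x => ¬ p x), a x) =
      ∑ y ∈ s'.filter (fun y => ¬ q y), b y - ∑ x ∈ s.filter (fun x => ¬ p x), a x := by ring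
  rw [e]
  calc |∑ y ∈ s'.filter (fun y => ¬ q y), b y - ∑ x ∈ s.filter (fun x => ¬ p x), a x|
      ≤ |∑ y ∈ s'.filter (fun y => ¬ q y), b y| + |∑ x ∈ s.filter (fun x => ¬ p x), a x| := abs_sub _ _
    _ ≤ τ' + τ := add_le_add ((Finset.abs_sum_le_sum_abs _ _).trans hτ') ((Finset.abs_sum_le_sum_abs _ _).trans hτ)
    _ = τ + τ' := add_comm _ _

/-! ## §2 At def-B's scalar kernel and at the window: volume increments of a localized sum from stability + tails -/

section Scalar

variable {𝔄 : Type*} [NormedRing 𝔄] [NormedAlgebra ℝ 𝔄] {V : Type*} [NormedAddCommGroup V] [NormedSpace ℝ V] {ι : Type*} [Fintype ι]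

/-- **VOLUME INCREMENT OF THE SCALAR KERNEL OF A LOCALIZED SUM FROM (S) + (T)**: two finite families of term functionals on two site types (consecutive tori), each exponential chart twice
continuously differentiable at `0`; (S) the «small» partial sums of the per-term scalar kernels at the corresponding sites AGREE; (T) the «large» absolute tails are `≤ τ`, `≤ τ′`.  Then the
scalar kernels of the two sums differ by at most `τ + τ′` (J27 `polScalar_finset_sum` + §1). -/
theorem abs_polScalar_sum_sub_polScalar_sum_le_of_stable_tail {Λ T Λ' T' 𝒳 𝒳' : Type*} [Fintype Λ] [Fintype T] [DecidableEq Λ] [DecidableEq T]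
    [Fintype Λ'] [Fintype T'] [DecidableEq Λ'] [DecidableEq T'] (s : Finset 𝒳) (s' : Finset 𝒳')
    (ℰ : 𝒳 → (Λ → T → 𝔄) → ℝ) (ℰ' : 𝒳' → (Λ' → T' → 𝔄) → ℝ) (ρ : V →L[ℝ] 𝔄) (bV : Module.Basis ι ℝ V)
    (hℰ : ∀ X ∈ s, ContDiffAt ℝ 2 (expChart (ℰ X) ρ) 0) (hℰ' : ∀ X ∈ s', ContDiffAt ℝ 2 (expChart (ℰ' X) ρ) 0)
    (μ : Λ) (x : T) (ν : Λ) (y : T) (μ' : Λ') (x' : T') (ν' : Λ') (y' : T') (p : 𝒳 → Prop) (q : 𝒳' → Prop) [DecidablePred p] [DecidablePred q]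
    (hstab : ∑ X ∈ s.filter p, polScalar (ℰ X) ρ bV μ x ν y = ∑ X ∈ s'.filter q, polScalar (ℰ' X) ρ bV μ' x' ν' y') {τ τ' : ℝ}
    (hτ : ∑ X ∈ s.filter (fun X => ¬ p X), |polScalar (ℰ X) ρ bV μ x ν y| ≤ τ)
    (hτ' : ∑ X ∈ s'.filter (fun X => ¬ q X), |polScalar (ℰ' X) ρ bV μ' x' ν' y'| ≤ τ') :
    |polScalar (fun U => ∑ X ∈ s', ℰ' X U) ρ bV μ' x' ν' y' - polScalar (fun U => ∑ X ∈ s, ℰ X U) ρ bV μ x ν y| ≤ τ + τ' := by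
  rw [polScalar_finset_sum s' ℰ' ρ bV hℰ', polScalar_finset_sum s ℰ ρ bV hℰ]
  exact abs_sum_sub_sum_le_of_stable s s' _ _ p q hstab hτ hτ'

/-- **THE SAME AT THE WINDOW, VOLUMES `K + 1` AND `K`**: def-B's `polWindow F K j ℰ ρ bV μ ν z` is `polScalar` at the window sites `(siteOfInt F K j z, siteOfInt F K j 0)` of the `K`-th torus;
(S) + (T) for two localized sums on the tori `T^{(j)}_K`, `T^{(j)}_{K+1}` give `|Π^{(K+1)}_{μν}(z) − Π^{(K)}_{μν}(z)| ≤ τ + τ′`. -/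
theorem abs_polWindow_succ_sub_polWindow_le_of_stable_tail (F : T4Family) (K j : ℕ) {𝒳 𝒳' : Type*} (s : Finset 𝒳) (s' : Finset 𝒳')
    (ℰ : 𝒳 → (Fin (F.P K).d → Site (F.P K) j → 𝔄) → ℝ) (ℰ' : 𝒳' → (Fin (F.P (K + 1)).d → Site (F.P (K + 1)) j → 𝔄) → ℝ)
    (ρ : V →L[ℝ] 𝔄) (bV : Module.Basis ι ℝ V)
    (hℰ : ∀ X ∈ s, ContDiffAt ℝ 2 (expChart (ℰ X) ρ) 0) (hℰ' : ∀ X ∈ s', ContDiffAt ℝ 2 (expChart (ℰ' X) ρ) 0)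
    (μ ν : Fin 4) (z : Fin 4 → ℤ) (p : 𝒳 → Prop) (q : 𝒳' → Prop) [DecidablePred p] [DecidablePred q]
    (hstab : ∑ X ∈ s.filter p, polScalar (ℰ X) ρ bV (Fin.cast (F.P_d K).symm μ) (siteOfInt F K j z) (Fin.cast (F.P_d K).symm ν) (siteOfInt F K j 0) =
      ∑ X ∈ s'.filter q, polScalar (ℰ' X) ρ bV (Fin.cast (F.P_d (K + 1)).symm μ) (siteOfInt F (K + 1) j z) (Fin.cast (F.P_d (K + 1)).symm ν) (siteOfInt F (K + 1) j 0))
    {τ τ' : ℝ}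
    (hτ : ∑ X ∈ s.filter (fun X => ¬ p X), |polScalar (ℰ X) ρ bV (Fin.cast (F.P_d K).symm μ) (siteOfInt F K j z) (Fin.cast (F.P_d K).symm ν) (siteOfInt F K j 0)| ≤ τ)
    (hτ' : ∑ X ∈ s'.filter (fun X => ¬ q X),
      |polScalar (ℰ' X) ρ bV (Fin.cast (F.P_d (K + 1)).symm μ) (siteOfInt F (K + 1) j z) (Fin.cast (F.P_d (K + 1)).symm ν) (siteOfInt F (K + 1) j 0)| ≤ τ') :
    |polWindow F (K + 1) j (fun U => ∑ X ∈ s', ℰ' X U) ρ bV μ ν z - polWindow F K j (fun U => ∑ X ∈ s, ℰ X U) ρ bV μ ν z| ≤ τ + τ' :=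
  abs_polScalar_sum_sub_polScalar_sum_le_of_stable_tail s s' ℰ ℰ' ρ bV hℰ hℰ' _ _ _ _ _ _ _ _ p q hstab hτ hτ'

end Scalar

/-! ## §3 Existence of the (1.21) limit of a `K`-indexed family of localized sums from (C²) + (S) + geometric (T) -/

section Limit

variable {𝔄 : Type*} [NormedRing 𝔄] [NormedAlgebra ℝ 𝔄] {V : Type*} [NormedAddCommGroup V] [NormedSpace ℝ V] {ι : Type*} [Fintype ι]
variable (F : T4Family) (j : ℕ) (ρ : V →L[ℝ] 𝔄) (bV : Module.Basis ι ℝ V)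

/-- ★ **«THIS LIMIT EXISTS BY THE LOCALIZED REPRESENTATION (1.7)» — SCHEMA**: a `K`-indexed family of localized sums `Σ_{X ∈ s K} ℰ K X` on the tori `T^{(j)}_K` with (C²) every exponential
chart twice continuously differentiable at `0`; (S) for each kernel entry `(μ, ν, z)`, from a threshold on, the partial sums of the per-term scalar kernels over the «small» terms (`lo K`
in volume `K`, `hi K` = their images in volume `K + 1`) AGREE across consecutive volumes; (T) the complementary absolute tails in both volumes are `≤ C r^K` with ONE `r < 1` — has
geometric volume-increments `2C r^K`, hence its (1.21) limits exist: def-B's `PolLimitExists F j (fun K U => Σ_{X ∈ s K} ℰ K X U) ρ bV`.  Every analytic input displayed. -/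
theorem polLimitExists_sum_of_stable_tail (𝒳 : ℕ → Type*) (s : (K : ℕ) → Finset (𝒳 K))
    (ℰ : (K : ℕ) → 𝒳 K → (Fin (F.P K).d → Site (F.P K) j → 𝔄) → ℝ) (hℰ : ∀ (K : ℕ), ∀ X ∈ s K, ContDiffAt ℝ 2 (expChart (ℰ K X) ρ) 0)
    (lo : (K : ℕ) → 𝒳 K → Prop) (hi : (K : ℕ) → 𝒳 (K + 1) → Prop) [∀ K, DecidablePred (lo K)] [∀ K, DecidablePred (hi K)] {r : ℝ} (hr : r < 1)
    (hST : ∀ (μ ν : Fin 4) (z : Fin 4 → ℤ), ∃ (K₀ : ℕ) (C : ℝ), ∀ K : ℕ, K₀ ≤ K →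
      (∑ X ∈ (s K).filter (lo K), polScalar (ℰ K X) ρ bV (Fin.cast (F.P_d K).symm μ) (siteOfInt F K j z) (Fin.cast (F.P_d K).symm ν) (siteOfInt F K j 0) =
        ∑ X ∈ (s (K + 1)).filter (hi K),
          polScalar (ℰ (K + 1) X) ρ bV (Fin.cast (F.P_d (K + 1)).symm μ) (siteOfInt F (K + 1) j z) (Fin.cast (F.P_d (K + 1)).symm ν) (siteOfInt F (K + 1) j 0)) ∧
      (∑ X ∈ (s K).filter (fun X => ¬ lo K X),
          |polScalar (ℰ K X) ρ bV (Fin.cast (F.P_d K).symm μ) (siteOfInt F K j z) (Fin.cast (F.P_d K).symm ν) (siteOfInt F K j 0)| ≤ C * r ^ K) ∧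
      (∑ X ∈ (s (K + 1)).filter (fun X => ¬ hi K X),
          |polScalar (ℰ (K + 1) X) ρ bV (Fin.cast (F.P_d (K + 1)).symm μ) (siteOfInt F (K + 1) j z) (Fin.cast (F.P_d (K + 1)).symm ν) (siteOfInt F (K + 1) j 0)| ≤
        C * r ^ K)) :
    PolLimitExists F j (fun K U => ∑ X ∈ s K, ℰ K X U) ρ bV := by
  refine polLimitExists_of_eventually_geometric_increments F j (fun K U => ∑ X ∈ s K, ℰ K X U) ρ bV hr fun μ ν z => ?_
  obtain ⟨K₀, C, h⟩ := hST μ ν z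
  refine ⟨K₀, 2 * C, fun K hK => ?_⟩
  obtain ⟨hS, hT, hT'⟩ := h K hK
  have := abs_polWindow_succ_sub_polWindow_le_of_stable_tail F K j (s K) (s (K + 1)) (ℰ K) (ℰ (K + 1)) ρ bV (hℰ K) (hℰ (K + 1)) μ ν z
    (lo K) (hi K) hS hT hT'
  linarith

end Limit

/-! ## §4 The instance at def-W1's W1-20 localized sum of a W1 reading (`Node00.localizedSum`, (1.7) ∕ [II] (2.14) at finite volume) -/

section Reading

open Literature.MathematicalPhysics.QuantumFieldTheory.Balaban1983to89.Node00.LocalizedSum17 (localizedSum ReadingMaps)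
open Literature.MathematicalPhysics.QuantumFieldTheory.Balaban1983to89.Node00.Sect2 (domSys)
open Literature.MathematicalPhysics.QuantumFieldTheory.Balaban1983to89.Node00.W1 (ClusterTower)
open Literature.MathematicalPhysics.QuantumFieldTheory.Balaban1983to89.Node00.U3OfKernels (histPrefix)
open scoped Matrix.Norms.L2Operator

variable {𝔸 : Type*} {M : ℕ} (F : T4Family) {V : Type*} [NormedAddCommGroup V] [NormedSpace ℝ V] {ι : Type*} [Fintype ι] {N : ℕ}

/-- ★ **THE (1.21) LIMITS OF THE KERNELS OF A W1 READING EXIST FROM TERM-LEVEL (C²) + (S) + (T)** — at def-W1's `localizedSum F S emb k (histPrefix g k)` (the finite-volume (1.7) sum of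
the reading's (2.13) terms through the reading-map `emb`), for every coupling sequence `g` of a window `W` and every level `k`: the `hlim` input of `ne9_EA_of_windowed` (N22), of
`kernelDecay_of_windowed` ((D4)) and of the N18 passage AT THE KERNEL OBJECTS OF THE READING.  All three laws displayed per `(g, k)`; their inhabitants for the towers of record are NODE A ∕
N10 ∕ def-W1 content, nobody's theorem today. -/
theorem polLimitExists_localizedSum_of_stable_tail (S : (K : ℕ) → ClusterTower (F.P K) 𝔸 M) (emb : ReadingMaps F (Matrix (Fin N) (Fin N) ℂ) 𝔸)
    (ρ : V →L[ℝ] Matrix (Fin N) (Fin N) ℂ) (bV : Module.Basis ι ℝ V) {W : Set (ℕ → ℝ)} {r : ℝ} (hr : r < 1)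
    (lo : (k K : ℕ) → (domSys (F.P K) M (k + 1)).Dom → Prop) (hi : (k K : ℕ) → (domSys (F.P (K + 1)) M (k + 1)).Dom → Prop)
    [∀ k K, DecidablePred (lo k K)] [∀ k K, DecidablePred (hi k K)]
    (hC2 : ∀ g ∈ W, ∀ (k K : ℕ) (X : (domSys (F.P K) M (k + 1)).Dom),
      ContDiffAt ℝ 2 (expChart (fun U => (((S K) k).E (histPrefix g k) (emb K k U) X).re) ρ) 0)
    (hST : ∀ g ∈ W, ∀ (k : ℕ) (μ ν : Fin 4) (z : Fin 4 → ℤ), ∃ (K₀ : ℕ) (C : ℝ), ∀ K : ℕ, K₀ ≤ K →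
      (∑ X ∈ (Finset.univ.filter (lo k K)),
          polScalar (fun U => (((S K) k).E (histPrefix g k) (emb K k U) X).re) ρ bV (Fin.cast (F.P_d K).symm μ) (siteOfInt F K (k + 1) z)
            (Fin.cast (F.P_d K).symm ν) (siteOfInt F K (k + 1) 0) =
        ∑ X ∈ (Finset.univ.filter (hi k K)),
          polScalar (fun U => (((S (K + 1)) k).E (histPrefix g k) (emb (K + 1) k U) X).re) ρ bV (Fin.cast (F.P_d (K + 1)).symm μ)
            (siteOfInt F (K + 1) (k + 1) z) (Fin.cast (F.P_d (K + 1)).symm ν) (siteOfInt F (K + 1) (k + 1) 0)) ∧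
      (∑ X ∈ (Finset.univ.filter (fun X => ¬ lo k K X)),
          |polScalar (fun U => (((S K) k).E (histPrefix g k) (emb K k U) X).re) ρ bV (Fin.cast (F.P_d K).symm μ) (siteOfInt F K (k + 1) z)
            (Fin.cast (F.P_d K).symm ν) (siteOfInt F K (k + 1) 0)| ≤ C * r ^ K) ∧
      (∑ X ∈ (Finset.univ.filter (fun X => ¬ hi k K X)),
          |polScalar (fun U => (((S (K + 1)) k).E (histPrefix g k) (emb (K + 1) k U) X).re) ρ bV (Fin.cast (F.P_d (K + 1)).symm μ)
            (siteOfInt F (K + 1) (k + 1) z) (Fin.cast (F.P_d (K + 1)).symm ν) (siteOfInt F (K + 1) (k + 1) 0)| ≤ C * r ^ K)) :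
    ∀ g ∈ W, ∀ k : ℕ, PolLimitExists F (k + 1) (fun K => localizedSum F S emb k (histPrefix g k) K) ρ bV := by
  intro g hg k
  exact polLimitExists_sum_of_stable_tail F (k + 1) ρ bV (fun K => (domSys (F.P K) M (k + 1)).Dom) (fun _ => Finset.univ)
    (fun K X U => (((S K) k).E (histPrefix g k) (emb K k U) X).re) (fun K X _ => hC2 g hg k K X) (lo k) (hi k) hr (hST g hg k)

end Reading

end YMDAG.N22.AtKernels

end
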